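import Mathlib
import Summits.ValiantsHypothesis.ValiantsHypothesis.Theorems.LiouvilleSarnakLiouvilleCutRankScatteredBlocks
import HarnessLib

/-!
# Route LiouvilleSarnak — crux `LiouvilleCutRank` (stmt-ValiantsHypothesis-14775):
# scattered blocks with a FREE FILLER, and the distinct-rows currency

`…ScatteredBlocks` (this hand, p831263) reduced the OPEN crux `LiouvilleCutRank` to the scattered-block hypothesis:
factors `CR` of a cut word at arbitrary positions `k 0 < ⋯ < k t` give the minor
`A_g(x, y) = λ(1 + Σ_i (2 x_i + y_i) 2^{g i})`, `g i = k i - k 0`, all other positions frozen to `1` below `k 0` and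
to `0` above.  The zeros are a choice, not a necessity: every position at or above `k 0` that is not a block position
may carry ANY fixed digit (a row position takes it in the row vector, a column position in the column vector), so the
cut matrix contains, for EVERY filler `H < 2^{2n - k 0}` whose digits vanish on the blocks, the minor
`λ(1 + H + Σ_i (2 x_i + y_i) 2^{g i})`.  This file records the resulting weaker sufficient condition, in which the
filler is the prover's to choose gap sequence by gap sequence, and its distinct-rows form:

* §1 `ofBits_or_of_disjoint`, `ofBits_blocks_filler` — digit arithmetic (blocks + filler with disjoint supports).
* §2 ★ `rank_blocks_filler_le_rank` — `rank (λ(1 + H + Σ_i (2 x_i + y_i) 2^{k i - p}))_{x,y} ≤ rank M_π` for factors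
  `CR` at `k i ≥ p`, prefix ones below `p`, and any filler `H < 2^{2n-p}` off the blocks.
* §3 ★ `le_rank_of_changes_ge_filler` (every level: `∃ H` per gap sequence with rank `≥ W` ⟹ every cut with
  `≥ 2t+1` letter changes has rank `≥ W`), ★★ `liouvilleCutRank_of_scatteredBlocks_filler`
  (`LiouvilleCutRank ⟸ ∀ W ∃ t ∀ g ∃ H`, rank `≥ W`), ★ `liouvilleCutRank_of_scatteredBlocks_distinctRows` (the same
  with "`≥ D` distinct rows" in place of rank, via `card_image_row_le_two_pow_rank` — the currency in which
  `…InterleavedUnbounded` settled the prototype `g i = 2i`).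

Example of a filler: all ones strictly between consecutive blocks telescopes the number to
`(d_t + 1) 2^{g t} - Σ_{i<t} (3 - d_i) 2^{g i}` (`d_i = 2 x_i + y_i`), i.e. `λ` at sparse perturbations BELOW the
four points `2^{g t}, 2^{g t + 1}, 3 · 2^{g t}, 2^{g t + 2}` instead of above `1`; with `d_i = 3` for `i < s` the
carry runs through and re-normalises the configuration at block `s` (the self-similarity used for `(CR)^n`).
Honest framing: bookkeeping that widens the target a proof of the scattered-block hypothesis may aim at; the
hypothesis itself (rank `→ ∞` uniformly in the gaps, for some filler) is open; `LiouvilleCutRank`,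
`DigitalBilinearLiouville`, `AlgebraicSarnak` stay OPEN; nothing bears on `VP ≠ VNP`.  No definitions.
-/

set_option linter.dupNamespace false

noncomputable section

namespace Summit.ValiantsHypothesis.ValiantsHypothesis.Theorems.LiouvilleSarnakLiouvilleCutRank.ScatteredBlocksFiller

open ArithmeticFunction Finset

open Summit.ValiantsHypothesis.ValiantsHypothesis.Theorems.LiouvilleSarnakAligned
  (liouville_two_pow_mul card_image_row_le_two_pow_rank)
open Literature.Computability.AlgebraicComplexity.BoolGadgets (ofBits_eq_sum)
open Summit.ValiantsHypothesis.ValiantsHypothesis.Theorems.LiouvilleSarnakLiouvilleCutRank.ScatteredBlocks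
  (ofBits_blocks ofBits_prefix_ones liouvilleCutRank_iff_manyChanges)
open Summit.ValiantsHypothesis.ValiantsHypothesis.Theorems.LiouvilleSarnakLiouvilleCutRank.CutTranspose
  (rank_cutMatrix_swap)
open Summit.ValiantsHypothesis.ValiantsHypothesis.Theses.LiouvilleSarnak (LiouvilleCutRank)

/-! ### §1 Digit arithmetic: blocks plus a filler supported off the blocks -/

/-- Merging two digit streams with disjoint supports adds the numbers. [folklore] -/
theorem ofBits_or_of_disjoint (L : ℕ) (a b : ℕ → Bool) (hab : ∀ q, a q = true → b q = false) :
    Nat.ofBits (fun q : Fin L => a q || b q) = Nat.ofBits (fun q : Fin L => a q) + Nat.ofBits (fun q : Fin L => b q) := by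
  rw [ofBits_eq_sum, ofBits_eq_sum, ofBits_eq_sum, ← Finset.sum_add_distrib]
  refine Finset.sum_congr rfl (fun q _ => ?_)
  have h := hab q
  cases ha : a (q : ℕ) <;> cases hb : b (q : ℕ) <;> simp_all

/-- The digits of `H < 2^L` on `L` positions give back `H`. [folklore] -/
theorem ofBits_testBit_eq (L H : ℕ) (hH : H < 2 ^ L) :
    Nat.ofBits (fun q : Fin L => H.testBit q) = H := by
  rw [Nat.ofBits_testBit, Nat.mod_eq_of_lt hH]

/-- Blocks plus filler: with block digits `x i` at `g i + 1`, `y i` at `g i`, and the digits of a filler `H < 2^L`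
vanishing at all block positions, the number is `Σ_i (2 x_i + y_i) 2^{g i} + H`. [folklore] -/
theorem ofBits_blocks_filler (L t : ℕ) (g : Fin t → ℕ) (hg : ∀ i j : Fin t, i < j → g i + 2 ≤ g j)
    (hL : ∀ i, g i + 1 < L) (H : ℕ) (hH : H < 2 ^ L)
    (hHb : ∀ i, H.testBit (g i) = false ∧ H.testBit (g i + 1) = false) (x y : Fin t → Bool) :
    Nat.ofBits (fun q : Fin L => (decide (∃ i : Fin t, (q : ℕ) = g i + 1 ∧ x i = true) ||
        decide (∃ i : Fin t, (q : ℕ) = g i ∧ y i = true)) || H.testBit q) =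
      (∑ i : Fin t, (2 * (x i).toNat + (y i).toNat) * 2 ^ (g i)) + H := by
  rw [ofBits_or_of_disjoint L (fun q => decide (∃ i : Fin t, q = g i + 1 ∧ x i = true) ||
        decide (∃ i : Fin t, q = g i ∧ y i = true)) (fun q => H.testBit q), ofBits_testBit_eq L H hH]
  · congr 1
    exact ofBits_blocks L t g hg hL x y
  · intro q hq
    simp only [Bool.or_eq_true, decide_eq_true_eq] at hq
    rcases hq with ⟨i, hi, -⟩ | ⟨i, hi, -⟩
    · rw [hi]; exact (hHb i).2
    · rw [hi]; exact (hHb i).1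

/-! ### §2 The scattered-block minor with a free filler -/

/-- ★ **Scattered `CR` blocks with a filler.**  As `ScatteredBlocks.rank_blocks_le_rank`, but the positions at or
above `p` that are not block positions carry the digits of an ARBITRARY filler `H < 2^{2n - p}` (digits of `H`
vanishing at the block positions `k i - p`, `k i + 1 - p`): row positions take their filler digit in the row vector,
column positions in the column vector.  Then `N + 1 = 2^p (1 + H + Σ_i (2 x_i + y_i) 2^{k i - p})`, so
`rank (λ(1 + H + Σ_i (2 x_i + y_i) 2^{k i - p}))_{x,y} ≤ rank M_π`. [this file] -/
theorem rank_blocks_filler_le_rank (n t p : ℕ) (π : Fin n ⊕ Fin n ≃ Fin (2 * n)) (w : ℕ → Bool)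
    (hw : ∀ j : Fin (2 * n), w j = (π.symm j).isLeft) (hp : p ≤ 2 * n) (k : Fin t → ℕ)
    (hpk : ∀ i, p ≤ k i) (hkn : ∀ i, k i + 1 < 2 * n)
    (hcol : ∀ i, w (k i) = false) (hrow : ∀ i, w (k i + 1) = true)
    (hgap : ∀ i j : Fin t, i < j → k i + 2 ≤ k j)
    (H : ℕ) (hH : H < 2 ^ (2 * n - p))
    (hHb : ∀ i, H.testBit (k i - p) = false ∧ H.testBit (k i - p + 1) = false) :
    (Matrix.of fun x y : Fin t → Bool =>
        (((liouville ((∑ i : Fin t, (2 * (x i).toNat + (y i).toNat) * 2 ^ (k i - p)) + H + 1) : ℤ) :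
          ℂ))).rank ≤
      (Matrix.of fun r c : Fin n → Bool =>
        (((liouville (Nat.ofBits (fun j : Fin (2 * n) => Sum.elim r c (π.symm j)) + 1) : ℤ) : ℂ))).rank := by
  set M := (Matrix.of fun r c : Fin n → Bool =>
      (((liouville (Nat.ofBits (fun j : Fin (2 * n) => Sum.elim r c (π.symm j)) + 1) : ℤ) : ℂ))) with hM
  set A := (Matrix.of fun x y : Fin t → Bool =>
      (((liouville ((∑ i : Fin t, (2 * (x i).toNat + (y i).toNat) * 2 ^ (k i - p)) + H + 1) : ℤ) : ℂ)))
    with hA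
  -- local digit stream (blocks, then filler) and the row / column embeddings
  let z : (Fin t → Bool) → (Fin t → Bool) → ℕ → Bool := fun x y q =>
    (decide (∃ i : Fin t, q = (k i - p) + 1 ∧ x i = true) || decide (∃ i : Fin t, q = (k i - p) ∧ y i = true)) ||
      H.testBit q
  let ρ : (Fin t → Bool) → (Fin n → Bool) := fun x i =>
    if (π (Sum.inl i) : ℕ) < p then true
    else decide (∃ i' : Fin t, (π (Sum.inl i) : ℕ) = k i' + 1 ∧ x i' = true) ||
      H.testBit ((π (Sum.inl i) : ℕ) - p)
  let γ : (Fin t → Bool) → (Fin n → Bool) := fun y i =>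
    if (π (Sum.inr i) : ℕ) < p then true
    else decide (∃ i' : Fin t, (π (Sum.inr i) : ℕ) = k i' ∧ y i' = true) ||
      H.testBit ((π (Sum.inr i) : ℕ) - p)
  -- (1) the global bit vector
  have hglob : ∀ x y (j : Fin (2 * n)), Sum.elim (ρ x) (γ y) (π.symm j) =
      (if (j : ℕ) < p then true else z x y ((j : ℕ) - p)) := by
    intro x y j
    rcases hj : π.symm j with i | i
    · have hji : π (Sum.inl i) = j := by rw [← hj, Equiv.apply_symm_apply]
      have hwj : w j = true := by rw [hw j, hj]; rfl
      rw [Sum.elim_inl]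
      show (if (π (Sum.inl i) : ℕ) < p then true
        else decide (∃ i' : Fin t, (π (Sum.inl i) : ℕ) = k i' + 1 ∧ x i' = true) ||
          H.testBit ((π (Sum.inl i) : ℕ) - p)) = _
      rw [hji]
      by_cases h1 : (j : ℕ) < p
      · rw [if_pos h1, if_pos h1]
      · rw [if_neg h1, if_neg h1]
        have hno : ¬ ∃ i' : Fin t, (j : ℕ) - p = k i' - p ∧ y i' = true := by
          rintro ⟨i', hi', -⟩
          have hjk : (j : ℕ) = k i' := by have := hpk i'; omega
          rw [hjk, hcol] at hwj
          exact Bool.false_ne_true hwj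
        have hiff : (∃ i' : Fin t, (j : ℕ) - p = k i' - p + 1 ∧ x i' = true) ↔
            (∃ i' : Fin t, (j : ℕ) = k i' + 1 ∧ x i' = true) := by
          constructor
          · rintro ⟨i', hi', hx⟩; exact ⟨i', by have := hpk i'; omega, hx⟩
          · rintro ⟨i', hi', hx⟩; exact ⟨i', by have := hpk i'; omega, hx⟩
        show _ = ((decide (∃ i' : Fin t, (j : ℕ) - p = k i' - p + 1 ∧ x i' = true) ||
          decide (∃ i' : Fin t, (j : ℕ) - p = k i' - p ∧ y i' = true)) || H.testBit ((j : ℕ) - p))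
        rw [decide_eq_false hno, Bool.or_false, Bool.decide_congr hiff]
    · have hji : π (Sum.inr i) = j := by rw [← hj, Equiv.apply_symm_apply]
      have hwj : w j = false := by rw [hw j, hj]; rfl
      rw [Sum.elim_inr]
      show (if (π (Sum.inr i) : ℕ) < p then true
        else decide (∃ i' : Fin t, (π (Sum.inr i) : ℕ) = k i' ∧ y i' = true) ||
          H.testBit ((π (Sum.inr i) : ℕ) - p)) = _
      rw [hji]
      by_cases h1 : (j : ℕ) < p
      · rw [if_pos h1, if_pos h1]
      · rw [if_neg h1, if_neg h1]
        have hno : ¬ ∃ i' : Fin t, (j : ℕ) - p = k i' - p + 1 ∧ x i' = true := by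
          rintro ⟨i', hi', -⟩
          have hjk : (j : ℕ) = k i' + 1 := by have := hpk i'; omega
          rw [hjk, hrow] at hwj
          exact Bool.noConfusion hwj
        have hiff : (∃ i' : Fin t, (j : ℕ) - p = k i' - p ∧ y i' = true) ↔
            (∃ i' : Fin t, (j : ℕ) = k i' ∧ y i' = true) := by
          constructor
          · rintro ⟨i', hi', hy⟩; exact ⟨i', by have := hpk i'; omega, hy⟩
          · rintro ⟨i', hi', hy⟩; exact ⟨i', by have := hpk i'; omega, hy⟩
        show _ = ((decide (∃ i' : Fin t, (j : ℕ) - p = k i' - p + 1 ∧ x i' = true) ||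
          decide (∃ i' : Fin t, (j : ℕ) - p = k i' - p ∧ y i' = true)) || H.testBit ((j : ℕ) - p))
        rw [decide_eq_false hno, Bool.false_or, Bool.decide_congr hiff]
  -- (2) the cut number
  have hnum : ∀ x y, Nat.ofBits (fun j : Fin (2 * n) => Sum.elim (ρ x) (γ y) (π.symm j)) + 1 =
      2 ^ p * (((∑ i : Fin t, (2 * (x i).toNat + (y i).toNat) * 2 ^ (k i - p)) + H) + 1) := by
    intro x y
    have hfun : (fun j : Fin (2 * n) => Sum.elim (ρ x) (γ y) (π.symm j)) =
        fun j : Fin (2 * n) => if (j : ℕ) < p then true else z x y ((j : ℕ) - p) :=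
      funext (hglob x y)
    rw [hfun, ofBits_prefix_ones (2 * n) p hp (z x y)]
    congr 2
    exact ofBits_blocks_filler (2 * n - p) t (fun i => k i - p)
      (by intro i j hij; have := hgap i j hij; have := hpk i; omega)
      (by intro i; have := hkn i; have := hpk i; omega) H hH hHb x y
  -- (3) entries, (4) submatrix and rank
  have hentry : ∀ x y, M (ρ x) (γ y) = (-1 : ℂ) ^ p * A x y := by
    intro x y
    simp only [hM, hA, Matrix.of_apply]
    rw [hnum x y, liouville_two_pow_mul]
    push_cast
    ring
  have hsub : M.submatrix ρ γ = ((-1 : ℂ) ^ p) • A := by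
    ext x y
    simp only [Matrix.submatrix_apply, Matrix.smul_apply, smul_eq_mul]
    exact hentry x y
  have hAeq : A = ((-1 : ℂ) ^ p) • M.submatrix ρ γ := by
    rw [hsub, smul_smul, ← mul_pow, neg_one_mul, neg_neg, one_pow, one_smul]
  calc A.rank = (((-1 : ℂ) ^ p) • M.submatrix ρ γ).rank := by rw [← hAeq]
    _ = (Matrix.diagonal (fun _ : Fin t → Bool => (-1 : ℂ) ^ p) * M.submatrix ρ γ).rank := by
        rw [Matrix.smul_eq_diagonal_mul]
    _ ≤ (M.submatrix ρ γ).rank := Matrix.rank_mul_le_right _ _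
    _ ≤ M.rank := Matrix.rank_submatrix_le M ρ γ

/-! ### §3 The crux from scattered blocks with a filler of one's choice, and in distinct-rows currency -/

/-- ★ **Many changes from filled scattered blocks, at every level.**  If for every normalised gap sequence
`0 = g 0 < ⋯ < g t` (gaps `≥ 2`) SOME filler `H < 2^{g t + 2}` with digits off the block positions gives
`rank (λ(1 + H + Σ_i (2 x_i + y_i) 2^{g i}))_{x,y} ≥ W`, then every cut (any level) with `≥ 2t + 1` letter changes
has rank `≥ W`. [this file] -/
theorem le_rank_of_changes_ge_filler (W t : ℕ)
    (ht : ∀ g : Fin (t + 1) → ℕ, g 0 = 0 → (∀ i j : Fin (t + 1), i < j → g i + 2 ≤ g j) →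
      ∃ H : ℕ, H < 2 ^ (g (Fin.last t) + 2) ∧ (∀ i, H.testBit (g i) = false ∧ H.testBit (g i + 1) = false) ∧
        W ≤ (Matrix.of fun x y : Fin (t + 1) → Bool =>
          (((liouville ((∑ i : Fin (t + 1), (2 * (x i).toNat + (y i).toNat) * 2 ^ (g i)) + H + 1) : ℤ) :
            ℂ))).rank)
    (n : ℕ) (π : Fin n ⊕ Fin n ≃ Fin (2 * n)) (w : ℕ → Bool)
    (hw : ∀ j : Fin (2 * n), w j = (π.symm j).isLeft)
    (hch : 2 * t + 1 ≤ ((range (2 * n - 1)).filter fun j => w j ≠ w (j + 1)).card) :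
    W ≤ (Matrix.of fun r c : Fin n → Bool =>
      (((liouville (Nat.ofBits (fun j : Fin (2 * n) => Sum.elim r c (π.symm j)) + 1) : ℤ) : ℂ))).rank := by
  classical
  have hstep : ∀ (π' : Fin n ⊕ Fin n ≃ Fin (2 * n)) (w' : ℕ → Bool),
      (∀ j : Fin (2 * n), w' j = (π'.symm j).isLeft) →
      t + 1 ≤ ((range (2 * n - 1)).filter fun j => w' j = false ∧ w' (j + 1) = true).card →
      W ≤ (Matrix.of fun r c : Fin n → Bool =>
        (((liouville (Nat.ofBits (fun j : Fin (2 * n) => Sum.elim r c (π'.symm j)) + 1) : ℤ) :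
          ℂ))).rank := by
    intro π' w' hw' hcard
    obtain ⟨S, hSsub, hScard⟩ := Finset.exists_subset_card_eq hcard
    let k : Fin (t + 1) → ℕ := fun i => S.orderEmbOfFin hScard i
    have hkS : ∀ i, k i ∈ S := fun i => Finset.orderEmbOfFin_mem S hScard i
    have hkmono : StrictMono k := (S.orderEmbOfFin hScard).strictMono
    have hkprop : ∀ i, k i < 2 * n - 1 ∧ w' (k i) = false ∧ w' (k i + 1) = true := by
      intro i
      have hmem := hSsub (hkS i)
      simpa [mem_filter, mem_range] using hmem
    have hgap : ∀ i j : Fin (t + 1), i < j → k i + 2 ≤ k j := by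
      intro i j hij
      have hlt : k i < k j := hkmono hij
      by_contra hcon
      have heq : k j = k i + 1 := by omega
      have h1 := (hkprop i).2.2
      have h2 := (hkprop j).2.1
      rw [heq, h1] at h2
      exact Bool.noConfusion h2
    have hk0 : ∀ i, k 0 ≤ k i := fun i => hkmono.monotone (Fin.zero_le i)
    obtain ⟨H, hH, hHb, hW⟩ := ht (fun i => k i - k 0) (by simp)
      (by intro i j hij; have := hgap i j hij; have := hk0 i; omega)
    have hH' : H < 2 ^ (2 * n - k 0) := by
      refine lt_of_lt_of_le hH (Nat.pow_le_pow_right (by norm_num) ?_)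
      have := (hkprop (Fin.last t)).1
      have := hk0 (Fin.last t)
      show k (Fin.last t) - k 0 + 2 ≤ 2 * n - k 0
      omega
    have hle := rank_blocks_filler_le_rank n (t + 1) (k 0) π' w' hw' (by have := (hkprop 0).1; omega) k hk0
      (fun i => by have := (hkprop i).1; omega) (fun i => (hkprop i).2.1) (fun i => (hkprop i).2.2) hgap
      H hH' (fun i => ⟨(hHb i).1, by simpa using (hHb i).2⟩)
    exact hW.trans hle
  have hsub : ((range (2 * n - 1)).filter fun j => w j ≠ w (j + 1)) ⊆
      ((range (2 * n - 1)).filter fun j => w j = false ∧ w (j + 1) = true) ∪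
      ((range (2 * n - 1)).filter fun j => w j = true ∧ w (j + 1) = false) := by
    intro j hj
    rw [mem_filter] at hj
    rw [mem_union, mem_filter, mem_filter]
    rcases hj with ⟨hjr, hne⟩
    cases h0 : w j <;> cases h1 : w (j + 1) <;> simp_all
  have hcard := hch.trans ((card_le_card hsub).trans (card_union_le _ _))
  by_cases hCR : t + 1 ≤ ((range (2 * n - 1)).filter fun j => w j = false ∧ w (j + 1) = true).card
  · exact hstep π w hw hCR
  · have hRC : t + 1 ≤ ((range (2 * n - 1)).filter fun j => w j = true ∧ w (j + 1) = false).card := by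
      omega
    have hw' : ∀ j : Fin (2 * n), (!w j) = (((Equiv.sumComm (Fin n) (Fin n)).trans π).symm j).isLeft := by
      intro j
      rw [hw j]
      show (!(π.symm j).isLeft) = (Sum.swap (π.symm j)).isLeft
      cases π.symm j <;> rfl
    have hfilter : ((range (2 * n - 1)).filter fun j => (!w j) = false ∧ (!w (j + 1)) = true) =
        ((range (2 * n - 1)).filter fun j => w j = true ∧ w (j + 1) = false) := by
      refine Finset.filter_congr (fun j _ => ?_)
      cases w j <;> cases w (j + 1) <;> simp
    have h := hstep ((Equiv.sumComm (Fin n) (Fin n)).trans π) (fun j => !w j) hw'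
      (by rw [hfilter]; exact hRC)
    rwa [rank_cutMatrix_swap] at h

/-- ★★ **`LiouvilleCutRank` from scattered blocks with a filler of one's choice.**  If for every `W` there is `t`
such that for every normalised gap sequence `0 = g 0 < g 1 < ⋯ < g t` (gaps `≥ 2`) SOME filler `H < 2^{g t + 2}` whose
binary digits vanish at the block positions `g i, g i + 1` makes
`rank (λ(1 + H + Σ_{i ≤ t} (2 x_i + y_i) 2^{g i}))_{x, y ∈ {0,1}^{t+1}} ≥ W`, then `LiouvilleCutRank`.  (`H = 0` is
`ScatteredBlocks.liouvilleCutRank_of_scatteredBlocks`; `H` = all ones strictly between consecutive blocks turns the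
numbers into `(d_t + 1) 2^{g t} - Σ_{i<t} (3 - d_i) 2^{g i}`, `d_i = 2 x_i + y_i`, by telescoping — the filler is the
prover's to choose, gap sequence by gap sequence.) [this file] -/
theorem liouvilleCutRank_of_scatteredBlocks_filler
    (h : ∀ W : ℕ, ∃ t : ℕ, ∀ g : Fin (t + 1) → ℕ, g 0 = 0 → (∀ i j : Fin (t + 1), i < j → g i + 2 ≤ g j) →
      ∃ H : ℕ, H < 2 ^ (g (Fin.last t) + 2) ∧ (∀ i, H.testBit (g i) = false ∧ H.testBit (g i + 1) = false) ∧
        W ≤ (Matrix.of fun x y : Fin (t + 1) → Bool =>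
          (((liouville ((∑ i : Fin (t + 1), (2 * (x i).toNat + (y i).toNat) * 2 ^ (g i)) + H + 1) : ℤ) :
            ℂ))).rank) :
    LiouvilleCutRank := by
  rw [liouvilleCutRank_iff_manyChanges]
  intro W
  obtain ⟨t, ht⟩ := h W
  exact ⟨2 * t + 1, 0, fun n _ π w hw hch => le_rank_of_changes_ge_filler W t ht n π w hw hch⟩

/-- ★ **Distinct-rows currency.**  If for every `D` there is `t` such that for every normalised gap sequence (gaps
`≥ 2`) some admissible filler `H` makes the scattered-block matrix `(λ(1 + H + Σ_i (2 x_i + y_i) 2^{g i}))_{x,y}`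
show at least `D` distinct ROWS, then `LiouvilleCutRank` — a `±1` matrix with `R` distinct rows has `R ≤ 2^{rank}`
(`LiouvilleSarnakAligned.card_image_row_le_two_pow_rank`); this is the currency in which the interleaved prototype was
settled (`…InterleavedUnbounded.infinite_range_of_oddRows`). [this file] -/
theorem liouvilleCutRank_of_scatteredBlocks_distinctRows
    (h : ∀ D : ℕ, ∃ t : ℕ, ∀ g : Fin (t + 1) → ℕ, g 0 = 0 → (∀ i j : Fin (t + 1), i < j → g i + 2 ≤ g j) →
      ∃ H : ℕ, H < 2 ^ (g (Fin.last t) + 2) ∧ (∀ i, H.testBit (g i) = false ∧ H.testBit (g i + 1) = false) ∧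
        D ≤ ((Finset.univ : Finset (Fin (t + 1) → Bool)).image fun x : Fin (t + 1) → Bool =>
          (Matrix.of fun x y : Fin (t + 1) → Bool =>
            (((liouville ((∑ i : Fin (t + 1), (2 * (x i).toNat + (y i).toNat) * 2 ^ (g i)) + H + 1) : ℤ) :
              ℂ))) x).card) :
    LiouvilleCutRank := by
  classical
  apply liouvilleCutRank_of_scatteredBlocks_filler
  intro W
  obtain ⟨t, ht⟩ := h (2 ^ W)
  refine ⟨t, fun g hg0 hgap => ?_⟩
  obtain ⟨H, hH, hHb, hD⟩ := ht g hg0 hgap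
  refine ⟨H, hH, hHb, ?_⟩
  set A := (Matrix.of fun x y : Fin (t + 1) → Bool =>
    (((liouville ((∑ i : Fin (t + 1), (2 * (x i).toNat + (y i).toNat) * 2 ^ (g i)) + H + 1) : ℤ) : ℂ)))
    with hA
  have hpm : ∀ x y, A x y = 1 ∨ A x y = -1 := by
    intro x y
    rw [hA, Matrix.of_apply, liouville_apply (Nat.succ_ne_zero _)]
    rcases neg_one_pow_eq_or ℤ
        (cardFactors ((∑ i : Fin (t + 1), (2 * (x i).toNat + (y i).toNat) * 2 ^ (g i)) + H + 1)) with h1 | h1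
    · left; rw [h1]; norm_num
    · right; rw [h1]; norm_num
  have hcard := card_image_row_le_two_pow_rank A hpm
  have h2 : 2 ^ W ≤ 2 ^ A.rank := hD.trans hcard
  exact (Nat.pow_le_pow_iff_right (by norm_num)).mp h2

end Summit.ValiantsHypothesis.ValiantsHypothesis.Theorems.LiouvilleSarnakLiouvilleCutRank.ScatteredBlocksFiller

end
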